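import Summits.CriticalPhenomena.Ising3D.TaylorTableOddHeadDeltaRows
import Summits.CriticalPhenomena.Ising3D.TaylorTableEvenHeadDeltaRows
import HarnessLib

/-!
# Head-row BRIDGE lemmas: `ValidΔ` is monotone in the box and reads the weights only on the index lists
(cell `pub-ising3x`, seat boot-1 gen 11; R17 (d) supplement (ε)/(ζ): the head rows' validity comes from the region file set's
`tab` + `rows` decides, whose record has if-chain weights restricted to the sector's components)

HONEST FRAMING: lottery ticket; floor = tightest certified 3D Ising CFT bounds; no exact-solution
claim without a proof. Island framing: certified exclusion region at stated derivative order and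
assumptions; not a determination of the 3D Ising critical exponents beyond that.

The γ-box theorem shapes take `hVE : HE.R.ValidΔ T.c T.L T.σlo T.σhi T.εlo T.εhi` (even head rows) and
`hVO : HO.R.ValidΔ T.c T.L T.ψ T.Lψ T.σlo T.σhi T.εlo T.εhi` (odd head rows). The literal route
(`HeadRowsΔ.validΔ_of_lit` / `OddHeadRowsΔ.validΔ_of_lit`) produces `ValidΔ` for the REGION record's weights `d.cQ`
(an if-chain carrying only the sector's components), its index lists and its box. The two lemmas below move such a
statement to the table's weights and box: `ValidΔ` is antitone in the box (it quantifies over the box) and depends on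
the weights only through `qSum` over `l.toFinset` in components `0, 1, 3, 4` (even) / `2, 3, 4` and `ψ` on `lψ` (odd)
(`qSum_congr_on`). Elementary; the per-box file instantiates them with `decide`d agreement hypotheses.
-/

namespace Summit.CriticalPhenomena.Ising3D

open Set Finset
open Literature.MathematicalPhysics.QuantumFieldTheory.ConformalBootstrap3D

/-- **`qSum` depends on the weights only through their values on the index set.** [folklore] -/
theorem qSum_congr_on {c c' : ℕ × ℕ → ℝ} {S : Finset (ℕ × ℕ)} (h : ∀ ab ∈ S, c ab = c' ab) (s σ E : ℝ) (j : ℕ) :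
    qSum c S s σ E j = qSum c' S s σ E j := by
  unfold qSum
  exact Finset.sum_congr rfl (fun ab hab => by rw [h ab hab])

/-- Cast form: rational weights agreeing on a list give equal real `qSum`s over `l.toFinset`. [folklore] -/
theorem qSum_congr_ratCast {c c' : ℕ × ℕ → ℚ} {l : List (ℕ × ℕ)} (h : ∀ ab ∈ l, c ab = c' ab) (s σ E : ℝ) (j : ℕ) :
    qSum (fun ab => (c ab : ℝ)) l.toFinset s σ E j = qSum (fun ab => (c' ab : ℝ)) l.toFinset s σ E j :=
  qSum_congr_on (fun ab hab => by rw [h ab (List.mem_toFinset.mp hab)]) s σ E j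

namespace HeadRowsΔ

/-- **Even head rows: `ValidΔ` transported to a sub-box and to weights agreeing in components 0, 1, 3, 4 on the list.**
[folklore] -/
theorem validΔ_mono_agree (R : HeadRowsΔ) {c c' : Fin 5 → ℕ × ℕ → ℚ} {l : List (ℕ × ℕ)}
    {σlo σhi εlo εhi σlo' σhi' εlo' εhi' : ℚ}
    (hσlo : σlo' ≤ σlo) (hσhi : σhi ≤ σhi') (hεlo : εlo' ≤ εlo) (hεhi : εhi ≤ εhi')
    (hc : ∀ ab ∈ l, c' 0 ab = c 0 ab ∧ c' 1 ab = c 1 ab ∧ c' 3 ab = c 3 ab ∧ c' 4 ab = c 4 ab)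
    (h : R.ValidΔ c' l σlo' σhi' εlo' εhi') : R.ValidΔ c l σlo σhi εlo εhi := by
  obtain ⟨hS, hWσ, hWε, hp⟩ := h
  refine ⟨hS, hWσ, hWε, fun p hpm => ?_⟩
  have hpm' : p ∈ Icc (σlo' : ℝ) σhi' ×ˢ Icc (εlo' : ℝ) εhi' := by
    simp only [Set.mem_prod, Set.mem_Icc] at hpm ⊢
    have h1 : ((σlo' : ℚ) : ℝ) ≤ (σlo : ℝ) := by exact_mod_cast hσlo
    have h2 : ((σhi : ℚ) : ℝ) ≤ (σhi' : ℝ) := by exact_mod_cast hσhi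
    have h3 : ((εlo' : ℚ) : ℝ) ≤ (εlo : ℝ) := by exact_mod_cast hεlo
    have h4 : ((εhi : ℚ) : ℝ) ≤ (εhi' : ℝ) := by exact_mod_cast hεhi
    exact ⟨⟨h1.trans hpm.1.1, hpm.1.2.trans h2⟩, ⟨h3.trans hpm.2.1, hpm.2.2.trans h4⟩⟩
  have q0 := fun s σ E j => qSum_congr_ratCast (c := c' 0) (c' := c 0) (l := l) (fun ab hab => (hc ab hab).1) s σ E j
  have q1 := fun s σ E j => qSum_congr_ratCast (c := c' 1) (c' := c 1) (l := l) (fun ab hab => (hc ab hab).2.1) s σ E j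
  have q3 := fun s σ E j => qSum_congr_ratCast (c := c' 3) (c' := c 3) (l := l) (fun ab hab => (hc ab hab).2.2.1) s σ E j
  have q4 := fun s σ E j => qSum_congr_ratCast (c := c' 4) (c' := c 4) (l := l) (fun ab hab => (hc ab hab).2.2.2) s σ E j
  have := hp p hpm'
  simp only [q0, q1, q3, q4] at this
  exact this

end HeadRowsΔ

namespace OddHeadRowsΔ

/-- **Odd head rows: `ValidΔ` transported to a sub-box, to weights agreeing in components 2, 3, 4 on `l` and to a majorant
agreeing on `lψ`.** [folklore] -/
theorem validΔ_mono_agree (R : OddHeadRowsΔ) {c c' : Fin 5 → ℕ × ℕ → ℚ} {l lψ : List (ℕ × ℕ)} {ψ ψ' : ℕ × ℕ → ℚ}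
    {σlo σhi εlo εhi σlo' σhi' εlo' εhi' : ℚ}
    (hσlo : σlo' ≤ σlo) (hσhi : σhi ≤ σhi') (hεlo : εlo' ≤ εlo) (hεhi : εhi ≤ εhi')
    (hc : ∀ ab ∈ l, c' 2 ab = c 2 ab ∧ c' 3 ab = c 3 ab ∧ c' 4 ab = c 4 ab) (hψ : ∀ ab ∈ lψ, ψ' ab = ψ ab)
    (h : R.ValidΔ c' l ψ' lψ σlo' σhi' εlo' εhi') : R.ValidΔ c l ψ lψ σlo σhi εlo εhi := by
  obtain ⟨hS, hWσ, hWε, hp⟩ := h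
  refine ⟨hS, hWσ, hWε, fun p hpm => ?_⟩
  have hpm' : p ∈ Icc (σlo' : ℝ) σhi' ×ˢ Icc (εlo' : ℝ) εhi' := by
    simp only [Set.mem_prod, Set.mem_Icc] at hpm ⊢
    have h1 : ((σlo' : ℚ) : ℝ) ≤ (σlo : ℝ) := by exact_mod_cast hσlo
    have h2 : ((σhi : ℚ) : ℝ) ≤ (σhi' : ℝ) := by exact_mod_cast hσhi
    have h3 : ((εlo' : ℚ) : ℝ) ≤ (εlo : ℝ) := by exact_mod_cast hεlo
    have h4 : ((εhi : ℚ) : ℝ) ≤ (εhi' : ℝ) := by exact_mod_cast hεhi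
    exact ⟨⟨h1.trans hpm.1.1, hpm.1.2.trans h2⟩, ⟨h3.trans hpm.2.1, hpm.2.2.trans h4⟩⟩
  have q2 := fun s σ E j => qSum_congr_ratCast (c := c' 2) (c' := c 2) (l := l) (fun ab hab => (hc ab hab).1) s σ E j
  have q3 := fun s σ E j => qSum_congr_ratCast (c := c' 3) (c' := c 3) (l := l) (fun ab hab => (hc ab hab).2.1) s σ E j
  have q4 := fun s σ E j => qSum_congr_ratCast (c := c' 4) (c' := c 4) (l := l) (fun ab hab => (hc ab hab).2.2) s σ E j
  have qψ := fun s σ E j => qSum_congr_ratCast (c := ψ') (c' := ψ) (l := lψ) hψ s σ E j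
  have := hp p hpm'
  simp only [q2, q3, q4, qψ] at this
  exact this

end OddHeadRowsΔ

end Summit.CriticalPhenomena.Ising3D
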